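import Summits.QuantumFields.YangMills.Theorems.TwistedTraceScaling.Negative.StrongCouplingTraceBridge
import Summits.QuantumFields.YangMills.Theorems.LuscherReductionTwistedTraceScalingBaseWindow
import Summits.QuantumFields.YangMills.Theorems.LuscherReductionTwistedTraceScalingOneSiteTraceLimit
import Summits.QuantumFields.YangMills.Theorems.TwistedTraceScaling.Negative.FixedLatticeTraceLawFalseWithoutThreshold
import Summits.QuantumFields.YangMills.Theorems.TwistedTraceScaling.Negative.StrongCouplingBranch
import HarnessLib

/-!
# `TwistedTraceScaling` (crux stmt-QuantumFields-20203, route `LuscherReduction`, skeleton «twolattice»):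
# negative-side support (R73c) — the hypothesis `1 ≤ β` of `InFemtoWindow` is load-bearing EVEN WITH the lattice threshold kept

HONEST FRAMING: `TwistedTraceScaling` is a femto-rung (R2b1) crux of a CONDITIONAL reduction route; nothing here is a mass-gap or
Clay statement, and this file does NOT refute the crux: it refutes the crux WITH ONE HYPOTHESIS REMOVED (spelled out inline — no
proposition is defined under `Summits/`).

`twistedTraceScaling_false_without_betaGeOne_keeping_threshold`: the crux with `InFemtoWindow lam β L` replaced by its two window
inequalities `lam ≤ Λ(β,L) ≤ 2·lam` (i.e. with `1 ≤ β` dropped) but with the lattice threshold `∃ L0, ∀ L ≥ L0` KEPT is false.  This closes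
the near-miss `false_without_betaGeOne_keeping_threshold` of the crux workfile (`Cruxes/TwistedTraceScaling/Disproof.lean` §E); the
earlier `FalseWithoutBetaGeOne` had to drop the threshold as well.  Witness: `s = 1`, `ε = (1 − r_𝔥(1))/4`; a depth
`lam ≤ min(lam0, 1/2, 1/max(B0,1), r·κ/(2b₀e^{κ/2}))` (`r` the Literature's strong-coupling radius for `su2Rep`, `κ = b₀/b₁`); AFTER the
adversary's threshold `L0(lam)`, a lattice `L ≥ max(L0, 1, 23040/(lam·4ε))`; the strong-coupling root `β ≤ 2b₀e^{κ/2}e^{−κ/lam³} ≤ r` of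
`Λ(β,L) = lam` (`exists_strong_window`).  There `T = ⌈L/lam⌉ ∈ [2L, 2L/lam]` and the VOLUME-UNIFORM bound
`StrongRoot.one_sub_le_traceRatio_of_strongCoupling` gives `r_L ≥ 1 − 24L³Te^{−⌊T/2⌋} ≥ 1 − 5760/(L·lam) ≥ 1 − ε`, while the one-site side
sits at `B = 2L³/lam³ ≥ B0` with `T·λ_b(B) ∈ [1, 1 + λ_b(B)]` and is within `ε` of `r_𝔥(1) = 1 − 4ε` (`TraceDoor.oneSiteTraceLimit`,
`Base.traceRatio_eq_levelRatio`).  Moral for provers: `1 ≤ β` is load-bearing ON ITS OWN — any proof of the crux must use it to exclude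
the strong-coupling root of the window inequalities, at every `L`.
-/

set_option autoImplicit false

noncomputable section

open MeasureTheory Filter Topology Real
open Literature.MathematicalPhysics.QuantumFieldTheory hiding SU2
open Literature.MathematicalPhysics.QuantumLattice
open Literature.Analysis.OperatorTheory.YMMatrixModel
open Literature.Analysis.OperatorTheory
open scoped InnerProductSpace BigOperators

namespace Summit.QuantumFields.YangMills.Theorems.TwistedTraceScaling.Negative

open Summit.QuantumFields.YangMills.Theorems.FemtoTransferGap
open Summit.QuantumFields.YangMills.Theorems.FemtoTransferGap.TT
open Summit.QuantumFields.YangMills.Theorems.FemtoTransferGap.PhysL2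
open Summit.QuantumFields.YangMills.Theorems.FemtoTransferGap.TraceDoor
open Summit.QuantumFields.YangMills.Theorems.FemtoTransferGap.TwoLattice

/-! ## The crux is false without `1 ≤ β`, KEEPING the lattice threshold `∃ L0, ∀ L ≥ L0` -/

/-- Bookkeeping: `24 x³ · (2x/y) · (120/x⁵) = 5760/(x y)`. [folklore] -/
theorem decay_algebra (x y : ℝ) (hx : 0 < x) (hy : 0 < y) :
    24 * x ^ 3 * (2 * x / y) * (120 / x ^ 5) = 5760 / (x * y) := by
  field_simp
  ring


/-- **`TwistedTraceScaling` is false without the hypothesis `1 ≤ β` of `InFemtoWindow`, with the lattice threshold `∃ L0, ∀ L ≥ L0` KEPT**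
(the statement is spelled out inline; it is the crux with `InFemtoWindow lam β L` replaced by its two window inequalities).  Witness:
`s = 1`, `ε = (1 − r_𝔥(1))/4`; a depth `lam ≤ min(lam0, 1/2, 1/max(B0,1), r·κ/(2b₀e^{κ/2}))` (`r` the strong-coupling radius of `su2Rep`,
`κ = b₀/b₁`); given the threshold `L0(lam)`, a lattice `L ≥ max(L0, 1, 23040/(lam·g))`; and the STRONG-coupling root `β ≤ 2b₀e^{κ/2}e^{−κ/lam³} ≤ r`
of `Λ(β, L) = lam` (`StrongCouplingBranch.exists_strong_window`).  There `T = ⌈L/lam⌉ ∈ [2L, 2L/lam]`, so the `L`-side ratio is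
`≥ 1 − 24L³·T·e^{−⌊T/2⌋} ≥ 1 − 48L⁴e^{−L}/lam ≥ 1 − 5760/(L·lam) ≥ 1 − ε` by the VOLUME-UNIFORM strong-coupling bound
`StrongRoot.one_sub_le_traceRatio_of_strongCoupling`, while the one-site side sits at `B = 2L³/lam³ ≥ B0` with `T·λ_b(B) = ⌈L/lam⌉·lam/L ∈
[1, 1 + λ_b(B)]` and is within `ε` of `r_𝔥(1) = 1 − 4ε` (`TraceDoor.oneSiteTraceLimit`, `Base.traceRatio_eq_levelRatio`). [folklore] -/
theorem twistedTraceScaling_false_without_betaGeOne_keeping_threshold :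
    ¬ (∀ s : ℝ, 0 < s → ∀ ε : ℝ, 0 < ε → ∃ lam0 : ℝ, 0 < lam0 ∧ ∀ lam : ℝ, 0 < lam → lam ≤ lam0 →
        ∃ L0 : ℕ, ∀ (L : ℕ) [NeZero L], L0 ≤ L → ∀ β : ℝ, lam ≤ luscherLambda β L → luscherLambda β L ≤ 2 * lam →
          |physTrace L β (2 * ⌈s * L / luscherLambda β L⌉₊) / physTrace L β ⌈s * L / luscherLambda β L⌉₊ ^ 2 -
            physTrace 1 (oneSiteCoupling β L) (2 * ⌈s * L / luscherLambda β L⌉₊) /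
              physTrace 1 (oneSiteCoupling β L) ⌈s * L / luscherLambda β L⌉₊ ^ 2| ≤ ε) := by
  intro h
  have hr1 : hTraceRatio 1 < 1 := hTraceRatio_lt_one one_pos
  obtain ⟨g, hg⟩ : ∃ g : ℝ, g = 1 - hTraceRatio 1 := ⟨_, rfl⟩
  have hg0 : 0 < g := by rw [hg]; linarith
  obtain ⟨lam0, hlam0, H⟩ := h 1 one_pos (g / 4) (by positivity)
  obtain ⟨B0, hO⟩ := oneSiteTraceLimit 1 one_pos (g / 4) (by positivity)
  have hb0 : 0 < b0 := by unfold b0; positivity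
  have hb1 : 0 < b1 := by unfold b1; positivity
  obtain ⟨κ, hκ⟩ : ∃ κ : ℝ, κ = b0 / b1 := ⟨_, rfl⟩
  have hκ0 : 0 < κ := by rw [hκ]; exact div_pos hb0 hb1
  obtain ⟨r, hr⟩ : ∃ r : ℝ, r = Balaban1983to89.Missing.strongCouplingRadius su2Rep := ⟨_, rfl⟩
  have hr0 : 0 < r := by rw [hr]; exact Balaban1983to89.Missing.strongCouplingRadius_pos su2Rep
  obtain ⟨M, hM⟩ : ∃ M : ℝ, M = max B0 1 := ⟨_, rfl⟩
  have hM1 : 1 ≤ M := by rw [hM]; exact le_max_right _ _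
  have hMB : B0 ≤ M := by rw [hM]; exact le_max_left _ _
  have hM0 : 0 < M := by linarith
  -- the depth `lam`
  obtain ⟨lam, hlam_pos, hlam_le0, hlam_half, hlam_M, hlam_r⟩ :
      ∃ lam : ℝ, 0 < lam ∧ lam ≤ lam0 ∧ lam ≤ 1 / 2 ∧ lam ≤ 1 / M ∧ lam ≤ r * κ / (2 * b0 * Real.exp (κ / 2)) := by
    refine ⟨min lam0 (min (1 / 2) (min (1 / M) (r * κ / (2 * b0 * Real.exp (κ / 2))))),
      lt_min hlam0 (lt_min (by norm_num) (lt_min (by positivity) (by positivity))), min_le_left _ _,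
      (min_le_right _ _).trans (min_le_left _ _),
      (min_le_right _ _).trans ((min_le_right _ _).trans (min_le_left _ _)),
      (min_le_right _ _).trans ((min_le_right _ _).trans (min_le_right _ _))⟩
  have hlam_one : lam ≤ 1 := by linarith
  -- the adversarial threshold
  obtain ⟨L0, HL⟩ := H lam hlam_pos hlam_le0
  -- the lattice size
  obtain ⟨L, hLL0, hL1, hLbig⟩ : ∃ L : ℕ, L0 ≤ L ∧ 1 ≤ L ∧ 23040 / (lam * g) ≤ (L : ℝ) := by
    refine ⟨max L0 (max 1 ⌈23040 / (lam * g)⌉₊), le_max_left _ _, le_trans (le_max_left _ _) (le_max_right _ _), ?_⟩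
    calc 23040 / (lam * g) ≤ (⌈23040 / (lam * g)⌉₊ : ℝ) := Nat.le_ceil _
      _ ≤ ((max L0 (max 1 ⌈23040 / (lam * g)⌉₊) : ℕ) : ℝ) := by
          exact_mod_cast le_trans (le_max_right _ _) (le_max_right _ _)
  haveI : NeZero L := ⟨by omega⟩
  have hLpos : (0 : ℝ) < L := by exact_mod_cast hL1
  have hL1r : (1 : ℝ) ≤ L := by exact_mod_cast hL1
  -- the strong-coupling root with `Λ(β, L) = lam`
  obtain ⟨β, hβ0, -, hβle, hΛ⟩ := exists_strong_window L hlam_pos hlam_one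
  -- the hypothesis at `(lam, L, β)`
  have hH := HL L hLL0 β (by rw [hΛ]) (by rw [hΛ]; linarith)
  simp only [one_mul, hΛ] at hH
  have hB : oneSiteCoupling β L = 2 * (L : ℝ) ^ 3 / lam ^ 3 := by unfold oneSiteCoupling; rw [hΛ]
  rw [hB] at hH
  obtain ⟨T, hT⟩ : ∃ T : ℕ, T = ⌈(L : ℝ) / lam⌉₊ := ⟨_, rfl⟩
  rw [← hT] at hH
  change |traceRatio L β T - traceRatio 1 (2 * (L : ℝ) ^ 3 / lam ^ 3) T| ≤ g / 4 at hH
  -- facts about `T = ⌈L/lam⌉`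
  have hinv : 2 * (L : ℝ) ≤ L / lam := by
    rw [le_div_iff₀ hlam_pos]; nlinarith
  have hceil : (L : ℝ) / lam ≤ T := by rw [hT]; exact Nat.le_ceil _
  have hceil' : (T : ℝ) < L / lam + 1 := by rw [hT]; exact Nat.ceil_lt_add_one (by positivity)
  have h2LT : 2 * L ≤ T := by
    have : (2 * L : ℝ) ≤ (T : ℝ) := hinv.trans hceil
    exact_mod_cast this
  have hT2 : 2 ≤ T := le_trans (by omega) h2LT
  have hLinv : (1 : ℝ) ≤ L / lam := by linarith
  have hTle : (T : ℝ) ≤ 2 * L / lam := by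
    have : (2 : ℝ) * L / lam = L / lam + L / lam := by ring
    linarith
  -- facts about `B = 2L³/lam³`
  have hlam3 : lam ^ 3 ≤ lam := by
    have h1 : lam ^ 2 ≤ 1 := by nlinarith
    nlinarith
  have hL3 : (1 : ℝ) ≤ (L : ℝ) ^ 3 := one_le_pow₀ hL1r
  have hBM : 2 * M ≤ 2 * (L : ℝ) ^ 3 / lam ^ 3 := by
    have h1 : M ≤ 1 / lam := by
      rw [le_div_iff₀ hlam_pos]
      calc M * lam ≤ M * (1 / M) := mul_le_mul_of_nonneg_left hlam_M hM0.le
        _ = 1 := by field_simp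
    have h2 : 1 / lam ≤ 1 / lam ^ 3 := one_div_le_one_div_of_le (by positivity) hlam3
    have h3 : (1 : ℝ) / lam ^ 3 ≤ (L : ℝ) ^ 3 / lam ^ 3 := div_le_div_of_nonneg_right hL3 (by positivity)
    have h4 : (2 : ℝ) * (L : ℝ) ^ 3 / lam ^ 3 = 2 * ((L : ℝ) ^ 3 / lam ^ 3) := by ring
    linarith
  have hB0 : B0 ≤ 2 * (L : ℝ) ^ 3 / lam ^ 3 := by linarith
  have hB1 : (1 : ℝ) ≤ 2 * (L : ℝ) ^ 3 / lam ^ 3 := by linarith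
  -- the one-site side: OSTL at `B = 2L³/lam³`, `T`
  have hbare : bareLambda (2 * (L : ℝ) ^ 3 / lam ^ 3) = lam / L := by
    have h1 := bareLambda_oneSiteCoupling (β := β) (L := L) (by rw [hΛ]; exact hlam_pos)
    rwa [hB, hΛ] at h1
  have hOT : |(T : ℝ) * bareLambda (2 * (L : ℝ) ^ 3 / lam ^ 3) - 1| ≤ bareLambda (2 * (L : ℝ) ^ 3 / lam ^ 3) := by
    rw [hbare, abs_le]
    constructor
    · have h1 : (1 : ℝ) ≤ T * (lam / L) := by
        calc (1 : ℝ) = (L / lam) * (lam / L) := by field_simp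
          _ ≤ T * (lam / L) := mul_le_mul_of_nonneg_right hceil (by positivity)
      have h2 : (0 : ℝ) < lam / L := by positivity
      linarith
    · have h1 : (T : ℝ) * (lam / L) < (L / lam + 1) * (lam / L) := mul_lt_mul_of_pos_right hceil' (by positivity)
      have h2 : ((L : ℝ) / lam + 1) * (lam / L) = 1 + lam / L := by field_simp
      linarith
  have hO1 := hO (2 * (L : ℝ) ^ 3 / lam ^ 3) hB0 T hOT
  rw [← Base.traceRatio_eq_levelRatio 1 hB1 hT2] at hO1
  -- the `L`-side at the strong-coupling root, by the VOLUME-UNIFORM strong-coupling expansion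
  have hβr : β ≤ Balaban1983to89.Missing.strongCouplingRadius su2Rep := by
    have he : Real.exp (-(b0 / b1) * (1 / lam ^ 3 - 1 / 2)) = Real.exp (κ / 2) * Real.exp (-(κ / lam ^ 3)) := by
      rw [← Real.exp_add, hκ]; congr 1; ring
    have hx : 0 < κ / lam ^ 3 := by positivity
    have hex : Real.exp (-(κ / lam ^ 3)) ≤ lam ^ 3 / κ := by
      have h1 : κ / lam ^ 3 + 1 ≤ Real.exp (κ / lam ^ 3) := Real.add_one_le_exp _
      rw [Real.exp_neg]
      calc (Real.exp (κ / lam ^ 3))⁻¹ ≤ (κ / lam ^ 3)⁻¹ := inv_anti₀ hx (by linarith)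
        _ = lam ^ 3 / κ := by rw [inv_div]
    rw [← hr]
    calc β ≤ 2 * b0 * Real.exp (-(b0 / b1) * (1 / lam ^ 3 - 1 / 2)) := hβle
      _ = 2 * b0 * Real.exp (κ / 2) * Real.exp (-(κ / lam ^ 3)) := by rw [he]; ring
      _ ≤ 2 * b0 * Real.exp (κ / 2) * (lam ^ 3 / κ) := mul_le_mul_of_nonneg_left hex (by positivity)
      _ ≤ 2 * b0 * Real.exp (κ / 2) * (lam / κ) :=
          mul_le_mul_of_nonneg_left (div_le_div_of_nonneg_right hlam3 hκ0.le) (by positivity)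
      _ ≤ 2 * b0 * Real.exp (κ / 2) * ((r * κ / (2 * b0 * Real.exp (κ / 2))) / κ) :=
          mul_le_mul_of_nonneg_left (div_le_div_of_nonneg_right hlam_r hκ0.le) (by positivity)
      _ = r := by field_simp
  have hlow := StrongRoot.one_sub_le_traceRatio_of_strongCoupling (L := L) hβ0 hβr hT2
  have hsmall : 24 * (L : ℝ) ^ 3 * T * Real.exp (-((T / 2 : ℕ) : ℝ)) ≤ g / 4 := by
    have hTL : (L : ℝ) ≤ ((T / 2 : ℕ) : ℝ) := by
      have : L ≤ T / 2 := by omega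
      exact_mod_cast this
    have hexpT : Real.exp (-((T / 2 : ℕ) : ℝ)) ≤ Real.exp (-(L : ℝ)) := Real.exp_le_exp.mpr (by linarith)
    have hexpL : Real.exp (-(L : ℝ)) ≤ 120 / (L : ℝ) ^ 5 := by
      have h := Real.pow_div_factorial_le_exp (L : ℝ) hLpos.le 5
      have h5 : ((Nat.factorial 5 : ℕ) : ℝ) = 120 := by norm_num [Nat.factorial]
      rw [h5] at h
      rw [Real.exp_neg]
      calc (Real.exp (L : ℝ))⁻¹ ≤ ((L : ℝ) ^ 5 / 120)⁻¹ := inv_anti₀ (by positivity) h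
        _ = 120 / (L : ℝ) ^ 5 := by rw [inv_div]
    have hkey : 23040 ≤ (L : ℝ) * (lam * g) := by rwa [div_le_iff₀ (by positivity)] at hLbig
    calc 24 * (L : ℝ) ^ 3 * T * Real.exp (-((T / 2 : ℕ) : ℝ))
        ≤ 24 * (L : ℝ) ^ 3 * (2 * L / lam) * (120 / (L : ℝ) ^ 5) := by
          apply mul_le_mul _ (hexpT.trans hexpL) (Real.exp_pos _).le (by positivity)
          exact mul_le_mul_of_nonneg_left hTle (by positivity)
      _ = 5760 / ((L : ℝ) * lam) := decay_algebra (L : ℝ) lam hLpos hlam_pos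
      _ ≤ g / 4 := by
          rw [div_le_div_iff₀ (by positivity) (by norm_num)]
          have h3 : g * ((L : ℝ) * lam) = L * (lam * g) := by ring
          linarith
  -- contradiction
  have h1 : traceRatio L β T - traceRatio 1 (2 * (L : ℝ) ^ 3 / lam ^ 3) T ≤ g / 4 := (abs_le.mp hH).2
  have h2 : traceRatio 1 (2 * (L : ℝ) ^ 3 / lam ^ 3) T - hTraceRatio 1 ≤ g / 4 := (abs_le.mp hO1).2
  linarith only [hlow, hsmall, h1, h2, hg, hg0]

end Summit.QuantumFields.YangMills.Theorems.TwistedTraceScaling.Negative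

end
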